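import Literature.Barriers.SmoothPoincare4.HCobordismInvariantsBlind
import Literature.Topology.FourManifolds.ThetaFourWall
import Literature.Topology.FourManifolds.PiStableFourCollapse
import Literature.Topology.FourManifolds.CylinderCobordism
import HarnessLib

/-!
# Barrier (SmoothPoincare4) `HCobordismInvariantBarrierFour`: what an unconditional proof must contain, and the barrier over the current leaves

Sibling proofs file of `HCobordismInvariantsBlind.lean` (barrier catalogue, D-0021), which vendors
`Literature.Barriers.SmoothPoincare4.HCobordismInvariantBarrierFour` — *no invariant of simply
connected closed smooth 4-manifolds that is constant on smooth h-cobordism classes (printed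
members: unitary `(3+1)`-dimensional TQFTs, Freedman–Kitaev–Nayak–Slingerland–Walker–Wang 2005,
Thms. 4.1–4.2) distinguishes a homotopy 4-sphere from `S⁴`* — and proves it
(`hCobordismInvariantBarrierFour_of_theta_four`) relative to the tree's named fact `Θ₄ = 0`
(`Literature.Topology.FourManifolds.isHCobordant_sphere_of_homotopySphere_four`; Kervaire–Milnor
1963, table p. 504). Fact seat `provefact-Literature.Barriers.SmoothPoincare4.HCob…`, triage
`SIZE: XL`. This file records, sorry-free and without touching the barrier file:

1. **Calibration** (`hCobordismInvariantBarrierFour_iff_eqvGen`): the barrier is EQUIVALENT to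
   "every homotopy 4-sphere is related to `S⁴` by the equivalence relation generated by smooth
   h-cobordism among simply connected closed smooth 4-manifolds" — because the technique class
   `IsHCobordismInvariant` has a universal member, the h-cobordism class itself
   (`ChartedFour.hCobordismClass`, `isHCobordismInvariant_iff_exists_comp_hCobordismClass`).
   GIVEN transitivity of h-cobordism (gluing of cobordisms along a common end, Milnor 1965
   Thm. 1.4; the tree's named fact `IsHCobordant.trans`, needed only with third end `S⁴`;
   reflexivity and symmetry being tree theorems) this is `Θ₄ = 0` itself
   (`hCobordismInvariantBarrierFour_iff_theta_four`). So no leaf smaller than `Θ₄ = 0` can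
   discharge the barrier, and its value universe is immaterial (`hCobordismInvariantBarrierFour_univ_iff`).
2. **The barrier over Wall's Thm. 2 alone** (`hCobordismInvariantBarrierFour_of_wallThmTwo`):
   by `ThetaFourWall.lean` (`Θ₄ = 0` GIVEN Wall 1964, Thm. 2, the intersection forms of `Σ` and
   `S⁴` both vanishing — proved over the tree's singular cohomology), the barrier follows from the
   single named fact `Literature.Topology.FourManifolds.isHCobordant_of_equivalent_intersectionForm`.
   This is the route PRINTED in the source: FKNSWW 2005, proof of Thm. 4.1 (§4), "It is well
   known that smooth homotopy equivalent 4-manifolds `P` and `Q` are smoothly h-cobordant".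
3. **The barrier over the Kervaire–Milnor leaves** (`hCobordismInvariantBarrierFour_of_leaves`,
   `…_of_collapseLeaves`), through the tree's decomposition of `Θ₄ = 0` along Kervaire–Milnor's
   proof (`ThetaFourKervaireMilnor.lean`, `PiStableFourCollapse.lean`), as in the sibling
   `StableInvariantsBlindProofs.lean`.

Nothing is discharged unconditionally: Wall's Thm. 2 (oriented cobordism, surgery, diffeomorphisms
of 4-dimensional handlebody boundaries; Wall 1964 §2) and each Kervaire–Milnor leaf (duality and
Whitehead's theorem; s-parallelizability; Pontryagin–Thom with `Π₄ = 0`; framed surgery) are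
theories absent from Mathlib and from the tree. `HCobordismInvariantBarrierFour` and `IsHCobordismInvariant` are
untouched; the auxiliary bundling `ChartedFour` is local to this calibration.

## References

* M. Freedman, A. Kitaev, C. Nayak, J. Slingerland, K. Walker, Z. Wang, *Universal manifold
  pairings and positivity*, Geom. Topol. 9 (2005) 2303–2317, Thm. 4.1 (proof) and Thm. 4.2.
  [FKNSWW2005]
* M. Kervaire, J. Milnor, *Groups of homotopy spheres I*, Ann. of Math. 77 (1963), §1, table
  p. 504 (`Θ₄ = 0`), Lemma 2.3, Thm. 3.1, §4, Thm. 5.1. [KervaireMilnorAnnals1963]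
* C. T. C. Wall, *On simply-connected 4-manifolds*, J. London Math. Soc. 39 (1964), Thm. 2.
  [WallJLMS1964]
* J. Milnor, *Lectures on the h-cobordism theorem* (1965), §1, Thm. 1.4. [MilnorHCobordism1965]
-/

noncomputable section

open scoped Manifold ContDiff
open ContinuousMap

namespace Literature.Barriers.SmoothPoincare4

universe u v

open Literature.Topology.FourManifolds

/-! ### 1. The barrier over Wall's Thm. 2 (the route printed by FKNSWW) -/

/-- **`HCobordismInvariantBarrierFour` GIVEN Wall 1964, Thm. 2 only.** No h-cobordism invariant of
simply connected closed smooth 4-manifolds distinguishes a homotopy 4-sphere from `S⁴`, GIVEN "two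
simply-connected closed 4-manifolds with isomorphic quadratic forms are h-cobordant"
(`isHCobordant_of_equivalent_intersectionForm`, hypothesis `hW`): `Θ₄ = 0` follows from it
(`isHCobordant_sphere_of_homotopySphere_four_of_wallThmTwo`, the forms of `Σ` and `S⁴` being zero)
and the barrier from `Θ₄ = 0` (`hCobordismInvariantBarrierFour_of_theta_four`). This is the
printed argument: "It is well known that smooth homotopy equivalent 4-manifolds `P` and `Q` are
smoothly h-cobordant … Hence `Z(P) = Z(Q)`" (FKNSWW 2005, proof of Thm. 4.1).
[cite: FKNSWW2005, proof of Thm. 4.1] [cite: WallJLMS1964, Thm. 2 (p. 141)] -/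
theorem hCobordismInvariantBarrierFour_of_wallThmTwo
    (hW : isHCobordant_of_equivalent_intersectionForm) : HCobordismInvariantBarrierFour.{u} :=
  hCobordismInvariantBarrierFour_of_theta_four
    (isHCobordant_sphere_of_homotopySphere_four_of_wallThmTwo hW)

/-! ### 2. The barrier over the Kervaire–Milnor leaves of `Θ₄ = 0` -/

/-- **`HCobordismInvariantBarrierFour` over the first-layer Kervaire–Milnor leaves**: GIVEN (2.3b)
the homotopy theory in Kervaire–Milnor's Lemma 2.3
(`NullCobordism.isHomotopyEquiv_compl_ball_of_contractibleSpace`), (3.1) homotopy spheres are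
s-parallelizable (`HomotopySphere.isStablyParallelizable`), (§4) an s-parallelizable homotopy
4-sphere bounds a parallelizable manifold, `Π₄ = 0`
(`HomotopySphere.boundsParallelizable_of_isStablyParallelizable_four`) and (5.1) Thm. 5.1 at
`k = 2` (`HomotopySphere.boundsContractible_of_nullCobordism_isStablyParallelizable_four`), through
`isHCobordant_sphere_of_homotopySphere_four_of_leaves` (`ThetaFourKervaireMilnor.lean`).
[cite: KervaireMilnorAnnals1963, table p. 504 (Θ₄ = 0) via Lemma 2.3, Thm. 3.1, §4 (table p. 512), Thm. 5.1] [cite: FKNSWW2005, Thm. 4.1] -/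
theorem hCobordismInvariantBarrierFour_of_leaves
    (h23b : NullCobordism.isHomotopyEquiv_compl_ball_of_contractibleSpace)
    (h31 : HomotopySphere.isStablyParallelizable)
    (h4 : HomotopySphere.boundsParallelizable_of_isStablyParallelizable_four)
    (h51 : HomotopySphere.boundsContractible_of_nullCobordism_isStablyParallelizable_four) :
    HCobordismInvariantBarrierFour.{u} :=
  hCobordismInvariantBarrierFour_of_theta_four
    (isHCobordant_sphere_of_homotopySphere_four_of_leaves h23b h31 h4 h51)

/-- **`HCobordismInvariantBarrierFour` over the refined Kervaire–Milnor leaves**: as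
`hCobordismInvariantBarrierFour_of_leaves`, with the §4 leaf replaced by its own printed
ingredients (`PiStableFourCollapse.lean`): (a) normally framed embeddings of s-parallelizable closed
manifolds (`exists_isSmoothEmbedding_isNormalFraming_of_isStablyParallelizable`), (b) Lemma 4.2 `⇒`
(`boundsParallelizable_of_collapseNullHomotopic`) and `Π₄ = 0` (`piStable_four_trivial`), through
`isHCobordant_sphere_of_homotopySphere_four_of_collapseLeaves`.
[cite: KervaireMilnorAnnals1963, Lemma 2.3, Thm. 3.1, §4 (p. 510, Lemma 4.2, table p. 512: Π₄ = 0), Thm. 5.1] [cite: FKNSWW2005, Thm. 4.1] -/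
theorem hCobordismInvariantBarrierFour_of_collapseLeaves
    (h23b : NullCobordism.isHomotopyEquiv_compl_ball_of_contractibleSpace)
    (h31 : HomotopySphere.isStablyParallelizable)
    (ha : exists_isSmoothEmbedding_isNormalFraming_of_isStablyParallelizable)
    (hb : boundsParallelizable_of_collapseNullHomotopic) (hPi : piStable_four_trivial)
    (h51 : HomotopySphere.boundsContractible_of_nullCobordism_isStablyParallelizable_four) :
    HCobordismInvariantBarrierFour.{u} :=
  hCobordismInvariantBarrierFour_of_theta_four
    (isHCobordant_sphere_of_homotopySphere_four_of_collapseLeaves h23b h31 ha hb hPi h51)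

/-! ### 3. Calibration: the barrier is `Θ₄ = 0` up to the equivalence closure of h-cobordism -/

/-- A 4-dimensional charted space in `Type`, bundled: exactly the arguments an invariant `I` of
the technique class `IsHCobordismInvariant` takes. Auxiliary to the calibration theorems of this
file. [folklore] -/
structure ChartedFour : Type 1 where
  /-- The underlying type. -/
  carrier : Type
  /-- Its topology. -/
  [topologicalSpace : TopologicalSpace carrier]
  /-- Its atlas, modelled on `ℝ⁴`. -/
  [chartedSpace : ChartedSpace (EuclideanSpace ℝ (Fin 4)) carrier]

attribute [instance] ChartedFour.topologicalSpace ChartedFour.chartedSpace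

namespace ChartedFour

/-- The standard `S⁴`, bundled. [folklore] -/
abbrev sphere : ChartedFour := ⟨Metric.sphere (0 : EuclideanSpace ℝ (Fin 5)) 1⟩

/-- `X` is a **simply connected closed smooth 4-manifold**: Hausdorff, second countable, `C^∞`,
compact, simply connected — the side conditions under which `IsHCobordismInvariant` constrains an
invariant (the printed scope of FKNSWW 2005, Thm. 4.1: "1-connected smooth 4-manifolds").
[cite: FKNSWW2005, Thm. 4.1] -/
structure IsClosedSC (X : ChartedFour) : Prop where
  /-- `X` is Hausdorff. -/
  [t2Space : T2Space X.carrier]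
  /-- `X` is second countable. -/
  [secondCountableTopology : SecondCountableTopology X.carrier]
  /-- `X` is a `C^∞` manifold modelled on `ℝ⁴`. -/
  [isManifold : IsManifold (𝓡 4) ∞ X.carrier]
  /-- `X` is compact. -/
  [compactSpace : CompactSpace X.carrier]
  /-- `X` is simply connected. -/
  [simplyConnectedSpace : SimplyConnectedSpace X.carrier]

/-- The generating relation of the technique class: `X` and `Y` are simply connected closed smooth
4-manifolds which are smoothly h-cobordant (`Literature.Topology.FourManifolds.IsHCobordant 4`).
Its equivalence closure `Relation.EqvGen IsHCobordantSC` is the relation "not separated by any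
h-cobordism invariant" (`hCobordismInvariantBarrierFour_iff_eqvGen`). [cite: FKNSWW2005, Thm. 4.1 (proof)] [cite: KervaireMilnorAnnals1963, §1] -/
def IsHCobordantSC (X Y : ChartedFour) : Prop :=
  X.IsClosedSC ∧ Y.IsClosedSC ∧
    Literature.Topology.FourManifolds.IsHCobordant 4 X.carrier Y.carrier

/-- The generating relation is symmetric (reverse the h-cobordism; Kervaire–Milnor 1963, §1).
[cite: KervaireMilnorAnnals1963, §1] -/
theorem IsHCobordantSC.symm {X Y : ChartedFour} (h : X.IsHCobordantSC Y) : Y.IsHCobordantSC X :=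
  ⟨h.2.1, h.1, h.2.2.symm⟩

/-- `S⁴` is a simply connected closed smooth 4-manifold (`π₁(S⁴) = 1`: Hatcher Prop. 1.14, tree
theorem `simplyConnectedSpace_sphere_four_holds`; the rest are Mathlib instances).
[cite: HatcherAT2002, Prop. 1.14] -/
theorem isClosedSC_sphere : sphere.IsClosedSC := by
  haveI : SimplyConnectedSpace (Metric.sphere (0 : EuclideanSpace ℝ (Fin 5)) 1) := simplyConnectedSpace_sphere_four_holds
  exact ⟨⟩

/-- The carrier of a homotopy 4-sphere is a simply connected closed smooth 4-manifold (simple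
connectivity transported along `Σ ≃ₕ S⁴`). [cite: KervaireMilnorAnnals1963, §1] [cite: HatcherAT2002, Prop. 1.14] -/
theorem isClosedSC_homotopySphere (S : HomotopySphere 4) : (⟨S.carrier⟩ : ChartedFour).IsClosedSC := by
  obtain ⟨e⟩ := S.nonempty_homotopyEquiv
  haveI : SimplyConnectedSpace (Metric.sphere (0 : EuclideanSpace ℝ (Fin 5)) 1) := simplyConnectedSpace_sphere_four_holds
  haveI : SimplyConnectedSpace S.carrier := e.simplyConnectedSpace
  exact ⟨⟩

/-- **The universal h-cobordism invariant**: the class of `X` in the quotient of `ChartedFour` by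
(the equivalence relation generated by) `IsHCobordantSC`. It belongs to the technique class
(`isHCobordismInvariant_hCobordismClass`), and a function `I` is in the technique class iff it is
of the form `f ∘ hCobordismClass` (`isHCobordismInvariant_iff_exists_comp_hCobordismClass`, by
`Quot.lift`). [cite: KervaireMilnorAnnals1963, §1 (h-cobordism classes)] -/
def hCobordismClass (X : ChartedFour) : Quot IsHCobordantSC :=
  Quot.mk _ X

end ChartedFour

/-- **The technique class, bundled form**: `I` is an h-cobordism invariant iff it takes equal values
on `IsHCobordantSC`-related bundled charted spaces. [cite: FKNSWW2005, Thm. 4.1 (proof) and Thm. 4.2] -/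
theorem isHCobordismInvariant_iff {α : Type*}
    {I : ∀ (M : Type) [TopologicalSpace M] [ChartedSpace (EuclideanSpace ℝ (Fin 4)) M], α} :
    IsHCobordismInvariant I ↔
      ∀ X Y : ChartedFour, X.IsHCobordantSC Y → I X.carrier = I Y.carrier := by
  constructor
  · rintro h ⟨M, tM, cM⟩ ⟨N, tN, cN⟩ ⟨⟨⟩, ⟨⟩, hMN⟩
    exact h M N hMN
  · intro h M N _ _ _ _ _ _ _ _ _ _ _ _ _ _ hMN
    exact h ⟨M⟩ ⟨N⟩ ⟨⟨⟩, ⟨⟩, hMN⟩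

/-- **The h-cobordism class is an h-cobordism invariant** (valued in `Type 1`): the technique class
has a universal member. [cite: KervaireMilnorAnnals1963, §1 (h-cobordism classes)] -/
theorem isHCobordismInvariant_hCobordismClass :
    IsHCobordismInvariant (fun (M : Type) [TopologicalSpace M] [ChartedSpace (EuclideanSpace ℝ (Fin 4)) M] =>
      ChartedFour.hCobordismClass ⟨M⟩) :=
  isHCobordismInvariant_iff.mpr fun _ _ hXY => Quot.sound hXY

/-- **Every h-cobordism invariant factors through the h-cobordism class, and conversely**: `I` is
in the technique class iff `I M = f [M]` for some function `f` on the quotient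
`Quot ChartedFour.IsHCobordantSC` (`⇒`: `f = Quot.lift I`, well defined precisely because `I` is
invariant; `⇐`: related manifolds have equal classes, `Quot.sound`). This is the universal property
behind the calibration below. [cite: KervaireMilnorAnnals1963, §1 (h-cobordism classes)] -/
theorem isHCobordismInvariant_iff_exists_comp_hCobordismClass {α : Type*}
    {I : ∀ (M : Type) [TopologicalSpace M] [ChartedSpace (EuclideanSpace ℝ (Fin 4)) M], α} :
    IsHCobordismInvariant I ↔
      ∃ f : Quot ChartedFour.IsHCobordantSC → α,
        ∀ (M : Type) [TopologicalSpace M] [ChartedSpace (EuclideanSpace ℝ (Fin 4)) M],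
          I M = f (ChartedFour.hCobordismClass ⟨M⟩) := by
  constructor
  · intro hI
    exact ⟨Quot.lift (fun X => I X.carrier) fun X Y h => isHCobordismInvariant_iff.mp hI X Y h,
      fun M _ _ => rfl⟩
  · rintro ⟨f, hf⟩
    exact isHCobordismInvariant_iff.mpr fun X Y hXY =>
      (hf X.carrier).trans ((congrArg f (Quot.sound hXY)).trans (hf Y.carrier).symm)

/-- **An h-cobordism invariant is constant on the equivalence closure of the generating
relation** (equality in `α` being an equivalence relation). [folklore] -/
theorem IsHCobordismInvariant.apply_eq_of_eqvGen {α : Type*}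
    {I : ∀ (M : Type) [TopologicalSpace M] [ChartedSpace (EuclideanSpace ℝ (Fin 4)) M], α}
    (hI : IsHCobordismInvariant I) {X Y : ChartedFour}
    (h : Relation.EqvGen ChartedFour.IsHCobordantSC X Y) : I X.carrier = I Y.carrier := by
  induction h with
  | rel X Y hXY => exact isHCobordismInvariant_iff.mp hI X Y hXY
  | refl _ => rfl
  | symm _ _ _ ih => exact ih.symm
  | trans _ _ _ _ _ ih₁ ih₂ => exact ih₁.trans ih₂

/-- **Calibration of the barrier.** `HCobordismInvariantBarrierFour` (at any value universe `u`)
holds iff every homotopy 4-sphere is related to `S⁴` by the equivalence relation generated by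
smooth h-cobordism among simply connected closed smooth 4-manifolds. (`⇐`: an invariant is
constant along such chains. `⇒`: apply the barrier to the `Prop`-valued invariant
`M ↦ EqvGen IsHCobordantSC ⟨M⟩ S⁴`, lifted to `Type u`.) Hence an unconditional proof of the barrier
must produce, for every homotopy 4-sphere `Σ`, actual smooth 5-dimensional h-cobordisms chaining
`Σ` to `S⁴` — i.e. `Θ₄ = 0` (Kervaire–Milnor 1963, table p. 504) up to gluing; see
`hCobordismInvariantBarrierFour_iff_theta_four`. [cite: KervaireMilnorAnnals1963, table p. 504 (Θ₄ = 0)] [cite: FKNSWW2005, Thm. 4.1] -/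
theorem hCobordismInvariantBarrierFour_iff_eqvGen :
    HCobordismInvariantBarrierFour.{u} ↔
      ∀ S : HomotopySphere 4,
        Relation.EqvGen ChartedFour.IsHCobordantSC ⟨S.carrier⟩ ChartedFour.sphere := by
  constructor
  · intro h S
    have hI : IsHCobordismInvariant
        (fun (M : Type) [TopologicalSpace M] [ChartedSpace (EuclideanSpace ℝ (Fin 4)) M] =>
          ULift.up.{u} (Relation.EqvGen ChartedFour.IsHCobordantSC ⟨M⟩ ChartedFour.sphere)) := by
      refine isHCobordismInvariant_iff.mpr fun X Y hXY => ULift.ext _ _ (propext ⟨fun hX => ?_, fun hY => ?_⟩)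
      · exact Relation.EqvGen.trans _ _ _ (Relation.EqvGen.rel _ _ hXY.symm) hX
      · exact Relation.EqvGen.trans _ _ _ (Relation.EqvGen.rel _ _ hXY) hY
    exact (congrArg ULift.down (h _ _ hI S)).mpr (Relation.EqvGen.refl _)
  · intro h α I hI S
    exact hI.apply_eq_of_eqvGen (h S)

/-- **`Θ₄ = 0` implies the chain form** (one generating step: `Σ` and `S⁴` are simply connected
closed smooth 4-manifolds and `Θ₄ = 0` makes them h-cobordant). [cite: KervaireMilnorAnnals1963, table p. 504 (Θ₄ = 0)] -/
theorem eqvGen_isHCobordantSC_of_theta_four (hΘ : isHCobordant_sphere_of_homotopySphere_four)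
    (S : HomotopySphere 4) :
    Relation.EqvGen ChartedFour.IsHCobordantSC ⟨S.carrier⟩ ChartedFour.sphere :=
  Relation.EqvGen.rel _ _
    ⟨ChartedFour.isClosedSC_homotopySphere S, ChartedFour.isClosedSC_sphere, hΘ S⟩

/-- Along a chain of the generating relation starting at a simply connected closed smooth
4-manifold, either nothing moved or the ends are `IsHCobordantSC`-related, GIVEN transitivity of
h-cobordism (gluing two h-cobordisms along the common end: Milnor 1965, Thm. 1.4; Kervaire–Milnor
1963, §1; the tree's named fact `IsHCobordant.trans`, hypothesis `htrans`; symmetry is the tree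
theorem `IsHCobordant.symm`). [cite: MilnorHCobordism1965, Thm. 1.4] [cite: KervaireMilnorAnnals1963, §1] -/
theorem ChartedFour.eq_or_isHCobordantSC_of_eqvGen
    (htrans : ∀ {M N P : Type} [TopologicalSpace M] [ChartedSpace (EuclideanSpace ℝ (Fin 4)) M] [TopologicalSpace N]
      [ChartedSpace (EuclideanSpace ℝ (Fin 4)) N] [TopologicalSpace P] [ChartedSpace (EuclideanSpace ℝ (Fin 4)) P],
      IsHCobordant.trans (n := 4) (M := M) (N := N) (P := P))
    {X Y : ChartedFour} (h : Relation.EqvGen IsHCobordantSC X Y) : X = Y ∨ X.IsHCobordantSC Y := by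
  induction h with
  | rel _ _ hXY => exact Or.inr hXY
  | refl _ => exact Or.inl rfl
  | symm _ _ _ ih =>
    rcases ih with rfl | hXY
    · exact Or.inl rfl
    · exact Or.inr hXY.symm
  | trans _ _ _ _ _ ih₁ ih₂ =>
    rcases ih₁ with rfl | ⟨hX, hY, hXY⟩
    · exact ih₂
    · rcases ih₂ with rfl | ⟨-, hZ, hYZ⟩
      · exact Or.inr ⟨hX, hY, hXY⟩
      · exact Or.inr ⟨hX, hZ, htrans hXY hYZ⟩

/-- **The chain form implies h-cobordism**, GIVEN transitivity of h-cobordism (`htrans`, the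
tree's named fact `IsHCobordant.trans`): a chain from a simply connected closed smooth `X` either
does not move (and `X` is h-cobordant to itself by the cylinder, tree theorem `isHCobordant_self`)
or composes to one h-cobordism. [cite: MilnorHCobordism1965, Thm. 1.4] [cite: KervaireMilnorAnnals1963, §1] -/
theorem ChartedFour.isHCobordant_of_eqvGen
    (htrans : ∀ {M N P : Type} [TopologicalSpace M] [ChartedSpace (EuclideanSpace ℝ (Fin 4)) M] [TopologicalSpace N]
      [ChartedSpace (EuclideanSpace ℝ (Fin 4)) N] [TopologicalSpace P] [ChartedSpace (EuclideanSpace ℝ (Fin 4)) P],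
      IsHCobordant.trans (n := 4) (M := M) (N := N) (P := P))
    {X Y : ChartedFour} (h : Relation.EqvGen IsHCobordantSC X Y) (hX : X.IsClosedSC) :
    Literature.Topology.FourManifolds.IsHCobordant 4 X.carrier Y.carrier := by
  rcases eq_or_isHCobordantSC_of_eqvGen htrans h with rfl | hXY
  · obtain ⟨⟩ := hX
    exact isHCobordant_self 4 X.carrier
  · exact hXY.2.2

/-- **Along a chain of the generating relation, "h-cobordant to `S⁴`" is invariant**, GIVEN
gluing of h-cobordisms onto h-cobordisms ending at `S⁴` (`htrans`: the tree's named fact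
`IsHCobordant.trans` with third end `P := S⁴` — Milnor 1965, Thm. 1.4; Kervaire–Milnor 1963, §1;
symmetry is the tree theorem `IsHCobordant.symm`): one generating step `X ~ Y` transports
`X ~ S⁴` to `Y ~ S⁴` (glue `Y ~ X ~ S⁴`) and back (glue `X ~ Y ~ S⁴`). Only this instance of
transitivity is needed for the calibration (`hCobordismInvariantBarrierFour_iff_theta_four`); the
general chain lemma is `ChartedFour.isHCobordant_of_eqvGen`.
[cite: MilnorHCobordism1965, Thm. 1.4] [cite: KervaireMilnorAnnals1963, §1] -/
theorem ChartedFour.isHCobordant_sphere_iff_of_eqvGen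
    (htrans : ∀ {M N : Type} [TopologicalSpace M] [ChartedSpace (EuclideanSpace ℝ (Fin 4)) M]
      [TopologicalSpace N] [ChartedSpace (EuclideanSpace ℝ (Fin 4)) N],
      IsHCobordant.trans (n := 4) (M := M) (N := N)
        (P := Metric.sphere (0 : EuclideanSpace ℝ (Fin 5)) 1))
    {X Y : ChartedFour} (h : Relation.EqvGen IsHCobordantSC X Y) :
    Literature.Topology.FourManifolds.IsHCobordant 4 X.carrier
        (Metric.sphere (0 : EuclideanSpace ℝ (Fin 5)) 1) ↔
      Literature.Topology.FourManifolds.IsHCobordant 4 Y.carrier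
        (Metric.sphere (0 : EuclideanSpace ℝ (Fin 5)) 1) := by
  induction h with
  | rel _ _ hXY => exact ⟨fun hX => htrans hXY.2.2.symm hX, fun hY => htrans hXY.2.2 hY⟩
  | refl _ => exact Iff.rfl
  | symm _ _ _ ih => exact ih.symm
  | trans _ _ _ _ _ ih₁ ih₂ => exact ih₁.trans ih₂

/-- **The chain form implies `Θ₄ = 0`**, GIVEN gluing of h-cobordisms onto h-cobordisms ending at
`S⁴` (`htrans`: the tree's named fact `IsHCobordant.trans` with `P := S⁴`): transport `S⁴ ~ S⁴`
(the cylinder, tree theorem `isHCobordant_self`) back along the chain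
(`ChartedFour.isHCobordant_sphere_iff_of_eqvGen`).
[cite: KervaireMilnorAnnals1963, table p. 504 (Θ₄ = 0) and §1] [cite: MilnorHCobordism1965, Thm. 1.4] -/
theorem isHCobordant_sphere_of_homotopySphere_four_of_eqvGen
    (htrans : ∀ {M N : Type} [TopologicalSpace M] [ChartedSpace (EuclideanSpace ℝ (Fin 4)) M]
      [TopologicalSpace N] [ChartedSpace (EuclideanSpace ℝ (Fin 4)) N],
      IsHCobordant.trans (n := 4) (M := M) (N := N)
        (P := Metric.sphere (0 : EuclideanSpace ℝ (Fin 5)) 1))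
    (h : ∀ S : HomotopySphere 4,
      Relation.EqvGen ChartedFour.IsHCobordantSC ⟨S.carrier⟩ ChartedFour.sphere) :
    isHCobordant_sphere_of_homotopySphere_four := fun S =>
  (ChartedFour.isHCobordant_sphere_iff_of_eqvGen htrans (h S)).mpr
    (isHCobordant_self 4 (Metric.sphere (0 : EuclideanSpace ℝ (Fin 5)) 1))

/-- **Calibration, sharp form: GIVEN gluing of h-cobordisms, the barrier IS `Θ₄ = 0`.** With
transitivity of h-cobordism towards `S⁴` (`htrans`: the tree's named fact `IsHCobordant.trans` at
`P := S⁴`, i.e. gluing an h-cobordism `M ~ N` to one `N ~ S⁴`; Milnor 1965 Thm. 1.4),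
`HCobordismInvariantBarrierFour.{u}` is equivalent to the tree's named fact
`isHCobordant_sphere_of_homotopySphere_four` (every homotopy 4-sphere is smoothly h-cobordant to
`S⁴`: Kervaire–Milnor 1963, table p. 504, `Θ₄ = 0`). In particular the unconditional discharge
`HCobordismInvariantBarrierFour_holds` is exactly as hard as `Θ₄ = 0` (Wall's Thm. 2, or the
Kervaire–Milnor leaves; §§1–2 above). [cite: KervaireMilnorAnnals1963, table p. 504 (Θ₄ = 0)] [cite: MilnorHCobordism1965, Thm. 1.4] [cite: FKNSWW2005, Thm. 4.1] -/
theorem hCobordismInvariantBarrierFour_iff_theta_four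
    (htrans : ∀ {M N : Type} [TopologicalSpace M] [ChartedSpace (EuclideanSpace ℝ (Fin 4)) M]
      [TopologicalSpace N] [ChartedSpace (EuclideanSpace ℝ (Fin 4)) N],
      IsHCobordant.trans (n := 4) (M := M) (N := N)
        (P := Metric.sphere (0 : EuclideanSpace ℝ (Fin 5)) 1)) :
    HCobordismInvariantBarrierFour.{u} ↔ isHCobordant_sphere_of_homotopySphere_four :=
  ⟨fun h => isHCobordant_sphere_of_homotopySphere_four_of_eqvGen htrans
      (hCobordismInvariantBarrierFour_iff_eqvGen.mp h),
    hCobordismInvariantBarrierFour_of_theta_four⟩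

/-- **The value universe is immaterial**: the barrier for invariants valued in `Type u` is
equivalent to the barrier for invariants valued in `Type v` (both are the universe-free chain
condition of `hCobordismInvariantBarrierFour_iff_eqvGen`). [folklore] -/
theorem hCobordismInvariantBarrierFour_univ_iff :
    HCobordismInvariantBarrierFour.{u} ↔ HCobordismInvariantBarrierFour.{v} :=
  hCobordismInvariantBarrierFour_iff_eqvGen.trans hCobordismInvariantBarrierFour_iff_eqvGen.symm

end Literature.Barriers.SmoothPoincare4

end
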